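import Summits.AtomisticToContinuum.Crystallization.Theorems.OverbindingBudgetAffineFarFieldCellSum

/-!
# OverbindingBudget (2c) — part 27V-L: the far-field LEDGER statement block (lens-4 g96; critic r1701 (β))

Support file, pure analysis on `ℝ³ = EuclideanSpace ℝ (Fin 3)`, NO atlas (r1701 (β): 27V-L quantifies over an
ABSTRACT finite family; the numerals of the desk live in part 27Vc only).  The block composes parts 27Vb-V
(B1)(B2)(A) by name into the ONE inequality the 31280 far-field column consumes (scheme B «27V-TWICE», DESK27V-g94
§1):

  `|Σ_{i∈t} P(y_i) − Σ_{j∈u} P(q_j) − DENSITY − ρ·CORE| ≤ Σ_{i∈t} e_i^act + |ρ|·Σ_{j∈u} |K_j^ref|·e_j^ref`,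

where `P(p) := g(p) + (σ/2)Δg(p)` (point values, ONE nominal `σ`), `DENSITY := Σ_i (|K_i|⁻¹ − ρ) ∫_{K_i} g` (paid by
the volume ledger of 27Vc), `CORE := ∫_{U_core^ref} g − ∫_{U_core^act} g` (the 27V-I interface integral; the main
term `∫_W g` of the two tessellations of the window `W` cancels EXACTLY), `e_i^act := η D₁ᵢ + (δ'/2) D₂ᵢ +
(τ'_{ℓ_i}/6) D₃ᵢ + (μ₄'/24) D₄ᵢ` with the LOOSE constants of the sandwich lemma `(η, δ', τ', μ₄') = (a r θ, δ₁a² +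
3|σ₁|ε(1+a) + 3|σ₁|θ + 3|σ₁ − σ| + (a r)²θ, τ_ℓ a³ + (a r)³θ, μ₄a⁴ + (a r)⁴θ)`, and `e_j^ref := (δ_j/2) E₂ⱼ +
(τ_j/6) E₃ⱼ + (μ₄ⱼ/24) E₄ⱼ` for the reference cells (exact centroids, `η = 0`); the actual defects are per POINT
(weights `1/|K_i|`), the reference defects per CELL (union form, weight `ρ`).

Binders (all symbolic, r1701 (β)(ii)): per LETTER `b` two template cells `Kin b ⊆ Kout b ⊆ B̄(0,r)` with `|Kout b| ≤
(1+θ)|Kin b|`, `Kin b` an exact moment cell about `0` with data `(σ₁, δ₁, μ₃, μ₄)` and structured cubic constant `τ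
b`; per actual mover `i` a letter `ℓ i`, a site `y i`, ONE chart `A i` with `‖A i − R i‖ ≤ ε`, `‖A i‖ ≤ a` for some
linear isometry `R i`, and a compact cell `K i`, star-shaped about `y i`, of positive volume, SANDWICHED `affMap 0
(y i) (A i) '' Kin (ℓ i) ⊆ K i ⊆ affMap 0 (y i) (A i) '' Kout (ℓ i)`; the actual cells pairwise a.e.-disjoint and,
with the actual core region, tiling the window a.e.; the reference cells loose moment cells with `η = 0` about their
sites, pairwise a.e.-disjoint and, with the reference core region, tiling the same window a.e.

* ★ `farField_ledger` — the inequality above;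
* `farField_ledger_unitDensity` — the same with `ρ|K_j^ref| = 1` (reference cells of volume `1/ρ`), reference point
  values un-weighted.
-/

namespace Summit.AtomisticToContinuum.Crystallization.Theorems.OverbindingBudgetAffineFarFieldCellLedger

noncomputable section

open Set Filter MeasureTheory
open scoped Topology
open Summit.AtomisticToContinuum.Crystallization.Theorems.OverbindingBudgetAffineFarFieldTaylor
open Summit.AtomisticToContinuum.Crystallization.Theorems.OverbindingBudgetAffineFarFieldCellTaylor
open Summit.AtomisticToContinuum.Crystallization.Theorems.OverbindingBudgetAffineFarFieldCellSymm
open Summit.AtomisticToContinuum.Crystallization.Theorems.OverbindingBudgetAffineFarFieldCellMove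
open Summit.AtomisticToContinuum.Crystallization.Theorems.OverbindingBudgetAffineFarFieldCellAffine
open Summit.AtomisticToContinuum.Crystallization.Theorems.OverbindingBudgetAffineFarFieldCellLoose
open Summit.AtomisticToContinuum.Crystallization.Theorems.OverbindingBudgetAffineFarFieldCellSandwich
open Summit.AtomisticToContinuum.Crystallization.Theorems.OverbindingBudgetAffineFarFieldCellSum

local notation "E3" => EuclideanSpace ℝ (Fin 3)

/-! ### The two sides separately -/

/-- ACTUAL SIDE of the ledger: the weighted far sum over sandwiched cells, loose data produced from the sandwich
binders by `isLooseMomentCell_of_sandwich` / `cubic_clause_of_sandwich` (parts 27Vb-V (B2)) and summed by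
`abs_sum_weighted_sub_le` (part (A)). -/
theorem actual_far_sum_le {ι : Type*} (t : Finset ι) {K : ι → Set E3} {y : ι → E3} {ℓ : ι → Bool}
    {A : ι → (E3 ≃L[ℝ] E3)} {R : ι → (E3 ≃ₗᵢ[ℝ] E3)} {Kin Kout : Bool → Set E3}
    {σ σ₁ δ₁ μ₃ μ₄ ε a r θ : ℝ} {τ : Bool → ℝ} {U : Set E3} {g : E3 → ℝ} {D₁ D₂ D₃ D₄ : ι → ℝ}
    (hin : ∀ b, IsMomentCell (Kin b) 0 σ₁ δ₁ μ₃ μ₄) (hμ₃ : 0 ≤ μ₃) (hμ₄ : 0 ≤ μ₄)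
    (hτ0 : ∀ b, 0 ≤ τ b)
    (hτ : ∀ b, ∀ B : E3 [×3]→L[ℝ] ℝ, |∫ x in Kin b, B (fun _ => x - 0)| ≤ τ b * (volume (Kin b)).toReal * ‖B‖)
    (hKout : ∀ b, IsCompact (Kout b)) (hsub : ∀ b, Kin b ⊆ Kout b) (hball : ∀ b, Kout b ⊆ Metric.closedBall 0 r)
    (hθ0 : 0 ≤ θ) (hθ : ∀ b, (volume (Kout b)).toReal ≤ (1 + θ) * (volume (Kin b)).toReal)
    (hε : ∀ i ∈ t, ‖(A i : E3 →L[ℝ] E3) - (R i).toLinearIsometry.toContinuousLinearMap‖ ≤ ε)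
    (ha : ∀ i ∈ t, ‖(A i : E3 →L[ℝ] E3)‖ ≤ a)
    (hK : ∀ i ∈ t, IsCompact (K i)) (hKs : ∀ i ∈ t, StarConvex ℝ (y i) (K i))
    (hvol : ∀ i ∈ t, 0 < (volume (K i)).toReal)
    (hIK : ∀ i ∈ t, affMap 0 (y i) (A i) '' Kin (ℓ i) ⊆ K i) (hKO : ∀ i ∈ t, K i ⊆ affMap 0 (y i) (A i) '' Kout (ℓ i))
    (hU : IsOpen U) (hKU : ∀ i ∈ t, K i ⊆ U) (hg : ContDiffOn ℝ 4 g U)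
    (h1 : ∀ i ∈ t, ‖fderiv ℝ g (y i)‖ ≤ D₁ i) (h2 : ∀ i ∈ t, ‖iteratedFDeriv ℝ 2 g (y i)‖ ≤ D₂ i)
    (h3 : ∀ i ∈ t, ‖iteratedFDeriv ℝ 3 g (y i)‖ ≤ D₃ i)
    (h4 : ∀ i ∈ t, ∀ x ∈ K i, ‖iteratedFDeriv ℝ 4 g x‖ ≤ D₄ i) :
    |∑ i ∈ t, ((volume (K i)).toReal⁻¹ * (∫ x in K i, g x) - (g (y i) + σ / 2 * lap g (y i)))|
      ≤ ∑ i ∈ t, (a * r * θ * D₁ i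
          + (δ₁ * a ^ 2 + 3 * |σ₁| * ε * (1 + a) + 3 * |σ₁| * θ + 3 * |σ₁ - σ| + (a * r) ^ 2 * θ) / 2 * D₂ i
          + (τ (ℓ i) * a ^ 3 + (a * r) ^ 3 * θ) / 6 * D₃ i + (μ₄ * a ^ 4 + (a * r) ^ 4 * θ) / 24 * D₄ i) := by
  refine abs_sum_weighted_sub_le t (η := fun _ => a * r * θ)
    (δ := fun _ => δ₁ * a ^ 2 + 3 * |σ₁| * ε * (1 + a) + 3 * |σ₁| * θ + 3 * |σ₁ - σ| + (a * r) ^ 2 * θ)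
    (μ₃ := fun i => μ₃ * a ^ 3 + (a * r) ^ 3 * θ) (μ₄ := fun _ => μ₄ * a ^ 4 + (a * r) ^ 4 * θ)
    (τ := fun i => τ (ℓ i) * a ^ 3 + (a * r) ^ 3 * θ)
    (fun i hi => ?_) (fun i hi => ?_) (fun i hi B => ?_) hvol hU hKU hg h1 h2 h3 h4
  · exact isLooseMomentCell_of_sandwich (hin (ℓ i)) hμ₃ hμ₄ (hKout (ℓ i)) (hsub (ℓ i)) (hball (ℓ i)) hθ0
      (hθ (ℓ i)) (hε i hi) (ha i hi) (hK i hi) (hKs i hi) (hIK i hi) (hKO i hi)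
  · have ha0 : 0 ≤ a := (norm_nonneg _).trans (ha i hi)
    have hr0 : 0 ≤ r := by
      have h0 : (0 : E3) ∈ Kout (ℓ i) := hsub (ℓ i) (hin (ℓ i)).2.2.1
      simpa using hball (ℓ i) h0
    have := hτ0 (ℓ i)
    positivity
  · exact cubic_clause_of_sandwich (hin (ℓ i)).1 (hτ0 (ℓ i)) (hτ (ℓ i)) (hKout (ℓ i)) (hsub (ℓ i)) (hball (ℓ i))
      (hin (ℓ i)).2.2.1 hθ0 (hθ (ℓ i)) (ha i hi) (hK i hi) (hIK i hi) (hKO i hi) B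

/-- REFERENCE SIDE of the ledger: loose moment cells with exact centroids (`η = 0`, e.g. the moved ideal cells of
part (A)), pairwise a.e.-disjoint, in UNION form (`abs_integral_biUnion_sub_sum_le`). -/
theorem reference_far_sum_le {κ : Type*} (u : Finset κ) {Kr : κ → Set E3} {q : κ → E3} {σ : ℝ}
    {δr μ₃r μ₄r τr E₂ E₃ E₄ : κ → ℝ} {U : Set E3} {g : E3 → ℝ}
    (hKr : ∀ j ∈ u, IsLooseMomentCell (Kr j) (q j) 0 σ (δr j) (μ₃r j) (μ₄r j))
    (hdr : (↑u : Set κ).Pairwise fun j j' => AEDisjoint volume (Kr j) (Kr j'))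
    (hτr0 : ∀ j ∈ u, 0 ≤ τr j)
    (hτr : ∀ j ∈ u, ∀ B : E3 [×3]→L[ℝ] ℝ,
      |∫ x in Kr j, B (fun _ => x - q j)| ≤ τr j * (volume (Kr j)).toReal * ‖B‖)
    (hU : IsOpen U) (hKrU : ∀ j ∈ u, Kr j ⊆ U) (hg : ContDiffOn ℝ 4 g U)
    (e2 : ∀ j ∈ u, ‖iteratedFDeriv ℝ 2 g (q j)‖ ≤ E₂ j) (e3 : ∀ j ∈ u, ‖iteratedFDeriv ℝ 3 g (q j)‖ ≤ E₃ j)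
    (e4 : ∀ j ∈ u, ∀ x ∈ Kr j, ‖iteratedFDeriv ℝ 4 g x‖ ≤ E₄ j) :
    |(∫ x in ⋃ j ∈ u, Kr j, g x) - ∑ j ∈ u, (volume (Kr j)).toReal * (g (q j) + σ / 2 * lap g (q j))|
      ≤ ∑ j ∈ u, (volume (Kr j)).toReal * (δr j / 2 * E₂ j + τr j / 6 * E₃ j + μ₄r j / 24 * E₄ j) := by
  have h := abs_integral_biUnion_sub_sum_le u (D₁ := fun j => ‖fderiv ℝ g (q j)‖) hKr hdr hτr0 hτr hU hKrU hg
    (fun j hj => le_rfl) e2 e3 e4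
  simpa only [zero_mul, zero_add] using h

/-! ### ★ The ledger -/

/-- ★ 27V-L, THE FAR-FIELD LEDGER (scheme B «27V-TWICE»; r1701 (β)): for two finite cell families tiling the same
window a.e. together with their core regions — the ACTUAL cells sandwiched per mover between ONE-chart affine images
of the letter's template cells, the REFERENCE cells loose moment cells with exact centroids — the difference of the
far point-value sums, corrected by the DENSITY term and `ρ` times the CORE (interface) integral, is bounded by the
summed per-cell quadrature defects.  No desk constant is inlined. -/
theorem farField_ledger {ι κ : Type*} (t : Finset ι) (u : Finset κ)
    {K : ι → Set E3} {y : ι → E3} {ℓ : ι → Bool} {A : ι → (E3 ≃L[ℝ] E3)} {R : ι → (E3 ≃ₗᵢ[ℝ] E3)}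
    {Kin Kout : Bool → Set E3} {σ σ₁ δ₁ μ₃ μ₄ ε a r θ ρ : ℝ} {τ : Bool → ℝ}
    {Kr : κ → Set E3} {q : κ → E3} {δr μ₃r μ₄r τr E₂ E₃ E₄ : κ → ℝ}
    {W Uc₁ Uc₂ U : Set E3} {g : E3 → ℝ} {D₁ D₂ D₃ D₄ : ι → ℝ}
    -- template cells per letter
    (hin : ∀ b, IsMomentCell (Kin b) 0 σ₁ δ₁ μ₃ μ₄) (hμ₃ : 0 ≤ μ₃) (hμ₄ : 0 ≤ μ₄) (hτ0 : ∀ b, 0 ≤ τ b)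
    (hτ : ∀ b, ∀ B : E3 [×3]→L[ℝ] ℝ, |∫ x in Kin b, B (fun _ => x - 0)| ≤ τ b * (volume (Kin b)).toReal * ‖B‖)
    (hKout : ∀ b, IsCompact (Kout b)) (hsub : ∀ b, Kin b ⊆ Kout b) (hball : ∀ b, Kout b ⊆ Metric.closedBall 0 r)
    (hθ0 : 0 ≤ θ) (hθ : ∀ b, (volume (Kout b)).toReal ≤ (1 + θ) * (volume (Kin b)).toReal)
    -- actual movers: one chart each, sandwiched compact star-shaped cells of positive volume, pairwise a.e.-disjoint
    (hε : ∀ i ∈ t, ‖(A i : E3 →L[ℝ] E3) - (R i).toLinearIsometry.toContinuousLinearMap‖ ≤ ε)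
    (ha : ∀ i ∈ t, ‖(A i : E3 →L[ℝ] E3)‖ ≤ a)
    (hK : ∀ i ∈ t, IsCompact (K i)) (hKs : ∀ i ∈ t, StarConvex ℝ (y i) (K i))
    (hvol : ∀ i ∈ t, 0 < (volume (K i)).toReal)
    (hIK : ∀ i ∈ t, affMap 0 (y i) (A i) '' Kin (ℓ i) ⊆ K i) (hKO : ∀ i ∈ t, K i ⊆ affMap 0 (y i) (A i) '' Kout (ℓ i))
    (hd : (↑t : Set ι).Pairwise fun i i' => AEDisjoint volume (K i) (K i'))
    -- reference cells: loose moment cells with exact centroids, pairwise a.e.-disjoint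
    (hKr : ∀ j ∈ u, IsLooseMomentCell (Kr j) (q j) 0 σ (δr j) (μ₃r j) (μ₄r j))
    (hdr : (↑u : Set κ).Pairwise fun j j' => AEDisjoint volume (Kr j) (Kr j'))
    (hτr0 : ∀ j ∈ u, 0 ≤ τr j)
    (hτr : ∀ j ∈ u, ∀ B : E3 [×3]→L[ℝ] ℝ,
      |∫ x in Kr j, B (fun _ => x - q j)| ≤ τr j * (volume (Kr j)).toReal * ‖B‖)
    -- the two tessellations of the window
    (hd₁ : AEDisjoint volume (⋃ i ∈ t, K i) Uc₁) (hc₁ : NullMeasurableSet Uc₁ volume)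
    (hcov₁ : ((⋃ i ∈ t, K i) ∪ Uc₁ : Set E3) =ᵐ[volume] W) (hci₁ : IntegrableOn g Uc₁)
    (hd₂ : AEDisjoint volume (⋃ j ∈ u, Kr j) Uc₂) (hc₂ : NullMeasurableSet Uc₂ volume)
    (hcov₂ : ((⋃ j ∈ u, Kr j) ∪ Uc₂ : Set E3) =ᵐ[volume] W) (hci₂ : IntegrableOn g Uc₂)
    -- the kernel and its derivative majorants
    (hU : IsOpen U) (hKU : ∀ i ∈ t, K i ⊆ U) (hKrU : ∀ j ∈ u, Kr j ⊆ U) (hg : ContDiffOn ℝ 4 g U)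
    (h1 : ∀ i ∈ t, ‖fderiv ℝ g (y i)‖ ≤ D₁ i) (h2 : ∀ i ∈ t, ‖iteratedFDeriv ℝ 2 g (y i)‖ ≤ D₂ i)
    (h3 : ∀ i ∈ t, ‖iteratedFDeriv ℝ 3 g (y i)‖ ≤ D₃ i)
    (h4 : ∀ i ∈ t, ∀ x ∈ K i, ‖iteratedFDeriv ℝ 4 g x‖ ≤ D₄ i)
    (e2 : ∀ j ∈ u, ‖iteratedFDeriv ℝ 2 g (q j)‖ ≤ E₂ j) (e3 : ∀ j ∈ u, ‖iteratedFDeriv ℝ 3 g (q j)‖ ≤ E₃ j)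
    (e4 : ∀ j ∈ u, ∀ x ∈ Kr j, ‖iteratedFDeriv ℝ 4 g x‖ ≤ E₄ j) :
    |(∑ i ∈ t, (g (y i) + σ / 2 * lap g (y i)))
        - ρ * (∑ j ∈ u, (volume (Kr j)).toReal * (g (q j) + σ / 2 * lap g (q j)))
        - (∑ i ∈ t, ((volume (K i)).toReal⁻¹ - ρ) * ∫ x in K i, g x)
        - ρ * ((∫ x in Uc₂, g x) - ∫ x in Uc₁, g x)|
      ≤ (∑ i ∈ t, (a * r * θ * D₁ i
          + (δ₁ * a ^ 2 + 3 * |σ₁| * ε * (1 + a) + 3 * |σ₁| * θ + 3 * |σ₁ - σ| + (a * r) ^ 2 * θ) / 2 * D₂ i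
          + (τ (ℓ i) * a ^ 3 + (a * r) ^ 3 * θ) / 6 * D₃ i + (μ₄ * a ^ 4 + (a * r) ^ 4 * θ) / 24 * D₄ i))
        + |ρ| * ∑ j ∈ u, (volume (Kr j)).toReal * (δr j / 2 * E₂ j + τr j / 6 * E₃ j + μ₄r j / 24 * E₄ j) := by
  -- the two one-sided bounds
  have hA := actual_far_sum_le t (σ := σ) hin hμ₃ hμ₄ hτ0 hτ hKout hsub hball hθ0 hθ hε ha hK hKs hvol hIK hKO hU
    hKU hg h1 h2 h3 h4
  have hR := reference_far_sum_le u hKr hdr hτr0 hτr hU hKrU hg e2 e3 e4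
  -- integrability and the union identities
  have hfK : ∀ i ∈ t, IntegrableOn g (K i) := fun i hi =>
    (hg.continuousOn.mono (hKU i hi)).integrableOn_compact (hK i hi)
  have hfKr : ∀ j ∈ u, IntegrableOn g (Kr j) := fun j hj =>
    (hg.continuousOn.mono (hKrU j hj)).integrableOn_compact (hKr j hj).isCompact
  have hsum : ∑ i ∈ t, ∫ x in K i, g x = ∫ x in ⋃ i ∈ t, K i, g x :=
    (integral_biUnion_finset₀ t (fun i hi => (hK i hi).measurableSet) hd hfK).symm
  have hwin := far_sub_far_eq_core_sub_core (g := g) hd₁ hc₁ hcov₁ ((integrableOn_finset_iUnion).2 hfK) hci₁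
    hd₂ hc₂ hcov₂ ((integrableOn_finset_iUnion).2 hfKr) hci₂
  -- algebra: the expression equals `−S_act + ρ S_ref`
  set Sa := ∑ i ∈ t, ((volume (K i)).toReal⁻¹ * (∫ x in K i, g x) - (g (y i) + σ / 2 * lap g (y i)))
    with hSa
  set Sr := (∫ x in ⋃ j ∈ u, Kr j, g x)
      - ∑ j ∈ u, (volume (Kr j)).toReal * (g (q j) + σ / 2 * lap g (q j)) with hSr
  have key : (∑ i ∈ t, (g (y i) + σ / 2 * lap g (y i)))
        - ρ * (∑ j ∈ u, (volume (Kr j)).toReal * (g (q j) + σ / 2 * lap g (q j)))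
        - (∑ i ∈ t, ((volume (K i)).toReal⁻¹ - ρ) * ∫ x in K i, g x)
        - ρ * ((∫ x in Uc₂, g x) - ∫ x in Uc₁, g x) = -Sa + ρ * Sr := by
    have e1 : ∑ i ∈ t, (g (y i) + σ / 2 * lap g (y i))
        = ∑ i ∈ t, (volume (K i)).toReal⁻¹ * (∫ x in K i, g x) - Sa := by
      rw [hSa, Finset.sum_sub_distrib]; ring
    have e2' : ∑ i ∈ t, ((volume (K i)).toReal⁻¹ - ρ) * ∫ x in K i, g x
        = ∑ i ∈ t, (volume (K i)).toReal⁻¹ * (∫ x in K i, g x) - ρ * ∑ i ∈ t, ∫ x in K i, g x := by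
      rw [Finset.mul_sum, ← Finset.sum_sub_distrib]
      refine Finset.sum_congr rfl fun i _ => ?_; ring
    rw [e1, e2', hsum, ← hwin, hSr]
    ring
  rw [key]
  calc |-Sa + ρ * Sr| ≤ |-Sa| + |ρ * Sr| := abs_add_le _ _
    _ = |Sa| + |ρ| * |Sr| := by rw [abs_neg, abs_mul]
    _ ≤ _ := add_le_add hA (mul_le_mul_of_nonneg_left hR (abs_nonneg ρ))

/-- The ledger at UNIT DENSITY: if every reference cell has volume `1/ρ` (`ρ|K_j| = 1`, e.g. the moved ideal cells
of volume `ν³/√2 = 1/ρ`), the reference point values enter un-weighted and the reference defects are per cell. -/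
theorem farField_ledger_unitDensity {ι κ : Type*} (t : Finset ι) (u : Finset κ)
    {K : ι → Set E3} {y : ι → E3} {ℓ : ι → Bool} {A : ι → (E3 ≃L[ℝ] E3)} {R : ι → (E3 ≃ₗᵢ[ℝ] E3)}
    {Kin Kout : Bool → Set E3} {σ σ₁ δ₁ μ₃ μ₄ ε a r θ ρ : ℝ} {τ : Bool → ℝ}
    {Kr : κ → Set E3} {q : κ → E3} {δr μ₃r μ₄r τr E₂ E₃ E₄ : κ → ℝ}
    {W Uc₁ Uc₂ U : Set E3} {g : E3 → ℝ} {D₁ D₂ D₃ D₄ : ι → ℝ}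
    (hin : ∀ b, IsMomentCell (Kin b) 0 σ₁ δ₁ μ₃ μ₄) (hμ₃ : 0 ≤ μ₃) (hμ₄ : 0 ≤ μ₄) (hτ0 : ∀ b, 0 ≤ τ b)
    (hτ : ∀ b, ∀ B : E3 [×3]→L[ℝ] ℝ, |∫ x in Kin b, B (fun _ => x - 0)| ≤ τ b * (volume (Kin b)).toReal * ‖B‖)
    (hKout : ∀ b, IsCompact (Kout b)) (hsub : ∀ b, Kin b ⊆ Kout b) (hball : ∀ b, Kout b ⊆ Metric.closedBall 0 r)
    (hθ0 : 0 ≤ θ) (hθ : ∀ b, (volume (Kout b)).toReal ≤ (1 + θ) * (volume (Kin b)).toReal)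
    (hε : ∀ i ∈ t, ‖(A i : E3 →L[ℝ] E3) - (R i).toLinearIsometry.toContinuousLinearMap‖ ≤ ε)
    (ha : ∀ i ∈ t, ‖(A i : E3 →L[ℝ] E3)‖ ≤ a)
    (hK : ∀ i ∈ t, IsCompact (K i)) (hKs : ∀ i ∈ t, StarConvex ℝ (y i) (K i))
    (hvol : ∀ i ∈ t, 0 < (volume (K i)).toReal)
    (hIK : ∀ i ∈ t, affMap 0 (y i) (A i) '' Kin (ℓ i) ⊆ K i) (hKO : ∀ i ∈ t, K i ⊆ affMap 0 (y i) (A i) '' Kout (ℓ i))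
    (hd : (↑t : Set ι).Pairwise fun i i' => AEDisjoint volume (K i) (K i'))
    (hKr : ∀ j ∈ u, IsLooseMomentCell (Kr j) (q j) 0 σ (δr j) (μ₃r j) (μ₄r j))
    (hdr : (↑u : Set κ).Pairwise fun j j' => AEDisjoint volume (Kr j) (Kr j'))
    (hτr0 : ∀ j ∈ u, 0 ≤ τr j)
    (hτr : ∀ j ∈ u, ∀ B : E3 [×3]→L[ℝ] ℝ,
      |∫ x in Kr j, B (fun _ => x - q j)| ≤ τr j * (volume (Kr j)).toReal * ‖B‖)
    (hρ0 : 0 ≤ ρ) (hρ : ∀ j ∈ u, ρ * (volume (Kr j)).toReal = 1)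
    (hd₁ : AEDisjoint volume (⋃ i ∈ t, K i) Uc₁) (hc₁ : NullMeasurableSet Uc₁ volume)
    (hcov₁ : ((⋃ i ∈ t, K i) ∪ Uc₁ : Set E3) =ᵐ[volume] W) (hci₁ : IntegrableOn g Uc₁)
    (hd₂ : AEDisjoint volume (⋃ j ∈ u, Kr j) Uc₂) (hc₂ : NullMeasurableSet Uc₂ volume)
    (hcov₂ : ((⋃ j ∈ u, Kr j) ∪ Uc₂ : Set E3) =ᵐ[volume] W) (hci₂ : IntegrableOn g Uc₂)
    (hU : IsOpen U) (hKU : ∀ i ∈ t, K i ⊆ U) (hKrU : ∀ j ∈ u, Kr j ⊆ U) (hg : ContDiffOn ℝ 4 g U)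
    (h1 : ∀ i ∈ t, ‖fderiv ℝ g (y i)‖ ≤ D₁ i) (h2 : ∀ i ∈ t, ‖iteratedFDeriv ℝ 2 g (y i)‖ ≤ D₂ i)
    (h3 : ∀ i ∈ t, ‖iteratedFDeriv ℝ 3 g (y i)‖ ≤ D₃ i)
    (h4 : ∀ i ∈ t, ∀ x ∈ K i, ‖iteratedFDeriv ℝ 4 g x‖ ≤ D₄ i)
    (e2 : ∀ j ∈ u, ‖iteratedFDeriv ℝ 2 g (q j)‖ ≤ E₂ j) (e3 : ∀ j ∈ u, ‖iteratedFDeriv ℝ 3 g (q j)‖ ≤ E₃ j)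
    (e4 : ∀ j ∈ u, ∀ x ∈ Kr j, ‖iteratedFDeriv ℝ 4 g x‖ ≤ E₄ j) :
    |(∑ i ∈ t, (g (y i) + σ / 2 * lap g (y i))) - (∑ j ∈ u, (g (q j) + σ / 2 * lap g (q j)))
        - (∑ i ∈ t, ((volume (K i)).toReal⁻¹ - ρ) * ∫ x in K i, g x)
        - ρ * ((∫ x in Uc₂, g x) - ∫ x in Uc₁, g x)|
      ≤ (∑ i ∈ t, (a * r * θ * D₁ i
          + (δ₁ * a ^ 2 + 3 * |σ₁| * ε * (1 + a) + 3 * |σ₁| * θ + 3 * |σ₁ - σ| + (a * r) ^ 2 * θ) / 2 * D₂ i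
          + (τ (ℓ i) * a ^ 3 + (a * r) ^ 3 * θ) / 6 * D₃ i + (μ₄ * a ^ 4 + (a * r) ^ 4 * θ) / 24 * D₄ i))
        + ∑ j ∈ u, (δr j / 2 * E₂ j + τr j / 6 * E₃ j + μ₄r j / 24 * E₄ j) := by
  have h := farField_ledger t u (ρ := ρ) hin hμ₃ hμ₄ hτ0 hτ hKout hsub hball hθ0 hθ hε ha hK hKs hvol hIK hKO hd
    hKr hdr hτr0 hτr hd₁ hc₁ hcov₁ hci₁ hd₂ hc₂ hcov₂ hci₂ hU hKU hKrU hg h1 h2 h3 h4 e2 e3 e4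
  have er : ρ * ∑ j ∈ u, (volume (Kr j)).toReal * (g (q j) + σ / 2 * lap g (q j))
      = ∑ j ∈ u, (g (q j) + σ / 2 * lap g (q j)) := by
    rw [Finset.mul_sum]
    exact Finset.sum_congr rfl fun j hj => by rw [← mul_assoc, hρ j hj, one_mul]
  have ed : |ρ| * ∑ j ∈ u, (volume (Kr j)).toReal * (δr j / 2 * E₂ j + τr j / 6 * E₃ j + μ₄r j / 24 * E₄ j)
      = ∑ j ∈ u, (δr j / 2 * E₂ j + τr j / 6 * E₃ j + μ₄r j / 24 * E₄ j) := by
    rw [abs_of_nonneg hρ0, Finset.mul_sum]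
    exact Finset.sum_congr rfl fun j hj => by rw [← mul_assoc, hρ j hj, one_mul]
  rw [er, ed] at h
  exact h

end

end Summit.AtomisticToContinuum.Crystallization.Theorems.OverbindingBudgetAffineFarFieldCellLedger
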